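import Mathlib
import Literature.Analysis.FluidPDE.Tao2016AveragedNS.CascadeTableDictionary
import Literature.Analysis.FluidPDE.Tao2016AveragedNS.LocalCascadeSolutions
import HarnessLib

/-!
# Route TaoLadderRungTwoBreak: the COMPARABLE CIRCUIT TABLE `circuitTable ρ p q g k` — the five-constant
  four-mode table of the cell's numerics (T4, B8, LS, A025, …) as a structure-constant table on Tao's
  shift set `S` (definitions module; cell harvest/h2-tao-ladder, seat p2; serves K1(1) =
  `NoSurvivingDSSOne`, stmt-NavierStokesRegularity-20205, whose quantifier `∀ α, InTableClass R α → …`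
  these tables instantiate)

The items of routes `TaoLadderRungTwo(Break)` quantify over tables `α : Fin 4 → Fin 4 → Fin 4 → ℤ³ → ℝ`
in the class `InTableClass R` (symmetric (4.2), cancelling (4.3), `R`-comparable on `S`). The cell's
screens and interval certificates (seat p2, `rung1/RUNG1-P2G*-REPORT.md`) are stated for «Tao's circuit
topology with comparable constants `(q, e, E, Λ, K)`»: the lattice
`u̇_k = Λ₀^k N(u_{k-1}, u_k, u_{k+1})`, `N = (−q c d − e a b − E a c + K d₋², e a² − Λ c², E a² + Λ b c,
q c a − Λ₀ K d a₊)`, `Λ₀ = (1+ε₀)^{5/2}` (`rung1/STAGE2-LEMMA.md` (1.1)). This module writes that lattice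
AS A TABLE: `circuitTable ρ p q g k` with `(ρ, p, q, g) = (q, e, E, Λ)_cell` and HAND-OFF ENTRY
`k = Λ₀ · K_cell` (the feed `K d_{k-1}²` carries the gain of the RECEIVING shell in the cell's
convention and of the EMITTING shell in Tao's (4.8), whence the factor `Λ₀`), symmetrised in the two
input slots as (4.2) requires. Contents:

* `circuitTable` and its support / value lemmas;
* `isSymmetricCoeff_circuitTable`, `isCancellingCoeff_circuitTable` — (4.2), (4.3) hold for ALL
  constants (the circuit is energy-conserving by design);
* `tableQ_circuitTable_apply`, `tableA_circuitTable_apply`, `tableB_circuitTable_apply` — the table's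
  structure maps ARE the circuit field: `Q = N_intra`, `A(x) = k x_d² e_a`, `B(y, x) = −k x_d y_a e_d`
  (so the tree normal form `Ẋ_n = Λ₀^n[Q(X_n) + B(X_{n+1}, X_n)] + Λ₀^{n-1}A(X_{n-1})` is (1.1));
* `isComparableCoeff_circuitTable` / `inTableClass_circuitTable`: for positive constants with
  `ρ ≤ 2`, `p, q, g, k ≤ 1` the table lies in `InTableClass R` as soon as
  `R⁻¹ ≤ min(ρ, p, q, g, k)/2` — NOTE the factor 2 from symmetrisation: the cell's «spread 7.5» table
  T4 = (1, 0.326, 0.134, 0.375, 0.618) is, as a TABLE, in `InTableClass (2/0.134) ≈ InTableClass 14.93`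
  (for `ε₀ ≤ 0.212`, where `k = 0.618 Λ₀ ≤ 1`), not `7.5`.

HONEST FRAMING: a definition and finite algebra about MODEL lattice tables (Tao 2016 §4 vocabulary);
nothing is asserted about their dynamics; nothing here is a statement about the Navier–Stokes equations.
-/

noncomputable section

-- the sub-problem namespace repeats the summit name by design (D-0017)
set_option linter.dupNamespace false

namespace Summit.NavierStokesRegularity.NavierStokesRegularity.Theorems

open Literature.Analysis.FluidPDE Literature.Analysis.FluidPDE.TaoCascade

/-- **The comparable circuit table** (modes `a b c d ↦ 0 1 2 3`; a term `α i₁ i₂ i₃ μ` drives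
`X_{i₃,n'+μ₃}` by `Λ₀^{n'} X_{i₁,n'+μ₁} X_{i₂,n'+μ₂}`). Intra-shell (`μ = 0`): `(c,d,a) = (d,c,a) = −ρ/2`,
`(a,b,a) = (b,a,a) = −p/2`, `(a,c,a) = (c,a,a) = −q/2`, `(a,a,b) = p`, `(c,c,b) = −g`, `(a,a,c) = q`,
`(b,c,c) = (c,b,c) = g/2`, `(c,a,d) = (a,c,d) = ρ/2`; hand-off `(d,d,a)@(0,0,1) = k`; back-reaction
`(d,a,d)@(0,1,0) = (a,d,d)@(1,0,0) = −k/2`; all else `0`.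
[cite: Tao2016AveragedNS, §4 (4.1)–(4.3) and §5 (the four-mode circuit: pump, amplifier, rotor, hand-off); cell vocabulary (comparable constants), route TaoLadderRungTwoBreak context] -/
def circuitTable (ρ p q g k : ℝ) : Fin 4 → Fin 4 → Fin 4 → ℤ × ℤ × ℤ → ℝ := fun i₁ i₂ i₃ μ =>
  if μ = (0, 0, 0) then
    (if (i₁ = 2 ∧ i₂ = 3 ∧ i₃ = 0) ∨ (i₁ = 3 ∧ i₂ = 2 ∧ i₃ = 0) then -ρ / 2
      else if (i₁ = 0 ∧ i₂ = 1 ∧ i₃ = 0) ∨ (i₁ = 1 ∧ i₂ = 0 ∧ i₃ = 0) then -p / 2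
      else if (i₁ = 0 ∧ i₂ = 2 ∧ i₃ = 0) ∨ (i₁ = 2 ∧ i₂ = 0 ∧ i₃ = 0) then -q / 2
      else if i₁ = 0 ∧ i₂ = 0 ∧ i₃ = 1 then p
      else if i₁ = 2 ∧ i₂ = 2 ∧ i₃ = 1 then -g
      else if i₁ = 0 ∧ i₂ = 0 ∧ i₃ = 2 then q
      else if (i₁ = 1 ∧ i₂ = 2 ∧ i₃ = 2) ∨ (i₁ = 2 ∧ i₂ = 1 ∧ i₃ = 2) then g / 2
      else if (i₁ = 2 ∧ i₂ = 0 ∧ i₃ = 3) ∨ (i₁ = 0 ∧ i₂ = 2 ∧ i₃ = 3) then ρ / 2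
      else 0)
  else if μ = (0, 0, 1) then (if i₁ = 3 ∧ i₂ = 3 ∧ i₃ = 0 then k else 0)
  else if μ = (0, 1, 0) then (if i₁ = 3 ∧ i₂ = 0 ∧ i₃ = 3 then -k / 2 else 0)
  else if μ = (1, 0, 0) then (if i₁ = 0 ∧ i₂ = 3 ∧ i₃ = 3 then -k / 2 else 0)
  else 0

/-- Symmetry (4.2) of the circuit table (all constants). [cite: Tao2016AveragedNS, §4 (4.2)] -/
theorem isSymmetricCoeff_circuitTable (ρ p q g k : ℝ) : IsSymmetricCoeff (circuitTable ρ p q g k) := by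
  intro i₁ i₂ i₃ μ₁ μ₂ μ₃ hμ
  rcases (mem_shiftSet_iff _).1 hμ with h | h | h | h <;>
    simp only [Prod.mk.injEq] at h <;> obtain ⟨rfl, rfl, rfl⟩ := h <;>
    fin_cases i₁ <;> fin_cases i₂ <;> fin_cases i₃ <;>
    simp [circuitTable]

/-- Cancellation (4.3) of the circuit table (all constants: the circuit conserves `Σ_n ‖X_n‖²`).
[cite: Tao2016AveragedNS, §4 (4.3)] -/
theorem isCancellingCoeff_circuitTable (ρ p q g k : ℝ) : IsCancellingCoeff (circuitTable ρ p q g k) := by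
  intro i₁ i₂ i₃ μ₁ μ₂ μ₃ hμ
  rcases (mem_shiftSet_iff _).1 hμ with h | h | h | h <;>
    simp only [Prod.mk.injEq] at h <;> obtain ⟨rfl, rfl, rfl⟩ := h <;>
    fin_cases i₁ <;> fin_cases i₂ <;> fin_cases i₃ <;>
    simp [circuitTable] <;> ring

/-- Every entry of the circuit table is one of `0, −ρ/2, −p/2, −q/2, p, −g, q, g/2, ρ/2, k, −k/2`.
[cite: Tao2016AveragedNS, §4 (4.1) (structure constants); cell vocabulary] -/
theorem circuitTable_values (ρ p q g k : ℝ) (i₁ i₂ i₃ : Fin 4) (μ : ℤ × ℤ × ℤ) :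
    circuitTable ρ p q g k i₁ i₂ i₃ μ = 0 ∨ circuitTable ρ p q g k i₁ i₂ i₃ μ = -ρ / 2 ∨
      circuitTable ρ p q g k i₁ i₂ i₃ μ = -p / 2 ∨ circuitTable ρ p q g k i₁ i₂ i₃ μ = -q / 2 ∨
      circuitTable ρ p q g k i₁ i₂ i₃ μ = p ∨ circuitTable ρ p q g k i₁ i₂ i₃ μ = -g ∨
      circuitTable ρ p q g k i₁ i₂ i₃ μ = q ∨ circuitTable ρ p q g k i₁ i₂ i₃ μ = g / 2 ∨
      circuitTable ρ p q g k i₁ i₂ i₃ μ = ρ / 2 ∨ circuitTable ρ p q g k i₁ i₂ i₃ μ = k ∨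
      circuitTable ρ p q g k i₁ i₂ i₃ μ = -k / 2 := by
  simp only [circuitTable]
  split_ifs <;> simp

/-- The circuit table is supported on Tao's shift set `S`. [cite: Tao2016AveragedNS, §4 after (4.1)] -/
theorem circuitTable_eq_zero_of_not_mem (ρ p q g k : ℝ) (i₁ i₂ i₃ : Fin 4) (μ : ℤ × ℤ × ℤ)
    (hμ : μ ∉ shiftSet) : circuitTable ρ p q g k i₁ i₂ i₃ μ = 0 := by
  rw [mem_shiftSet_iff] at hμ
  push Not at hμ
  obtain ⟨h1, h2, h3, h4⟩ := hμ
  simp [circuitTable, h1, h2, h3, h4]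

/-- **The intra-shell field of the circuit table is the circuit**: `(Q x)_a = −ρ x_c x_d − p x_a x_b − q x_a x_c`,
`(Q x)_b = p x_a² − g x_c²`, `(Q x)_c = q x_a² + g x_b x_c`, `(Q x)_d = ρ x_c x_a`.
[cite: Tao2016AveragedNS, §4 (4.1), (4.8) and §5 (circuit); cell vocabulary] -/
theorem tableQ_circuitTable_apply (ρ p q g k : ℝ) (x : Em 4) :
    tableQ (circuitTable ρ p q g k) x 0 = -ρ * x 2 * x 3 - p * x 0 * x 1 - q * x 0 * x 2 ∧
    tableQ (circuitTable ρ p q g k) x 1 = p * x 0 ^ 2 - g * x 2 ^ 2 ∧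
    tableQ (circuitTable ρ p q g k) x 2 = q * x 0 ^ 2 + g * x 1 * x 2 ∧
    tableQ (circuitTable ρ p q g k) x 3 = ρ * x 2 * x 0 := by
  refine ⟨?_, ?_, ?_, ?_⟩ <;>
  · rw [tableQ_apply, qform]
    simp [Fin.sum_univ_four, circuitTable]
    ring

/-- **The outflow of the circuit table is the hand-off** `A(x) = k x_d² e_a`.
[cite: Tao2016AveragedNS, §4 (4.1), (4.8) and §5 (hand-off `X_{4,n} → X_{1,n+1}`); cell vocabulary] -/
theorem tableA_circuitTable_apply (ρ p q g k : ℝ) (x : Em 4) (i : Fin 4) :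
    tableA (circuitTable ρ p q g k) x i = if i = 0 then k * x 3 ^ 2 else 0 := by
  rw [tableA_apply, qform]
  fin_cases i <;> simp [Fin.sum_univ_four, circuitTable]
  exact Or.inl (by ring)

/-- **The back-reaction of the circuit table**: `B(y, x) = −k x_d y_a e_d` (shell holding `x`, shell
above holding `y`). [cite: Tao2016AveragedNS, §4 (4.1), (4.8) and §5; cell vocabulary] -/
theorem tableB_circuitTable_apply (ρ p q g k : ℝ) (y x : Em 4) (i : Fin 4) :
    tableB (circuitTable ρ p q g k) y x i = if i = 3 then -(k * x 3 * y 0) else 0 := by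
  rw [tableB_apply, qform, qform]
  fin_cases i <;> simp [Fin.sum_univ_four, circuitTable]
  ring

/-- **Comparability of the circuit table.** For positive constants with `ρ ≤ 2`, `p, q, g, k ≤ 1` and
`R⁻¹ ≤ ρ/2, p/2, q/2, g/2, k/2`, every entry on `S` has modulus `≤ 1` and every non-zero entry has
modulus `≥ R⁻¹` (the binding entries are the SYMMETRISED halves).
[cite: Tao2016AveragedNS, §6.1 (6.1)–(6.4) (the table being compared); cell vocabulary (`IsComparableCoeff`)] -/
theorem isComparableCoeff_circuitTable {ρ p q g k R : ℝ} (hρ : 0 < ρ) (hρ1 : ρ ≤ 2)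
    (hp : 0 < p) (hp1 : p ≤ 1) (hq : 0 < q) (hq1 : q ≤ 1) (hg : 0 < g) (hg1 : g ≤ 1)
    (hk : 0 < k) (hk1 : k ≤ 1) (hRρ : R⁻¹ ≤ ρ / 2) (hRp : R⁻¹ ≤ p / 2) (hRq : R⁻¹ ≤ q / 2)
    (hRg : R⁻¹ ≤ g / 2) (hRk : R⁻¹ ≤ k / 2) :
    IsComparableCoeff R (circuitTable ρ p q g k) := by
  intro i₁ i₂ i₃ μ _hμ
  rcases circuitTable_values ρ p q g k i₁ i₂ i₃ μ with h | h | h | h | h | h | h | h | h | h | h <;>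
    rw [h]
  · simp
  · rw [show -ρ / 2 = -(ρ / 2) by ring, abs_neg, abs_of_pos (by positivity)]
    exact ⟨by linarith, Or.inr hRρ⟩
  · rw [show -p / 2 = -(p / 2) by ring, abs_neg, abs_of_pos (by positivity)]
    exact ⟨by linarith, Or.inr hRp⟩
  · rw [show -q / 2 = -(q / 2) by ring, abs_neg, abs_of_pos (by positivity)]
    exact ⟨by linarith, Or.inr hRq⟩
  · rw [abs_of_pos hp]; exact ⟨hp1, Or.inr (by linarith)⟩
  · rw [abs_neg, abs_of_pos hg]; exact ⟨hg1, Or.inr (by linarith)⟩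
  · rw [abs_of_pos hq]; exact ⟨hq1, Or.inr (by linarith)⟩
  · rw [abs_of_pos (by positivity)]; exact ⟨by linarith, Or.inr hRg⟩
  · rw [abs_of_pos (by positivity)]; exact ⟨by linarith, Or.inr hRρ⟩
  · rw [abs_of_pos hk]; exact ⟨hk1, Or.inr (by linarith)⟩
  · rw [show -k / 2 = -(k / 2) by ring, abs_neg, abs_of_pos (by positivity)]
    exact ⟨by linarith, Or.inr hRk⟩

/-- **The circuit table is in the class E₂(R)** under the hypotheses of
`isComparableCoeff_circuitTable`. Example: T4 = (ρ,p,q,g) = (1, 0.326, 0.134, 0.375), `k = 0.618 Λ₀ ≤ 1`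
(`ε₀ ≤ 0.212`) lies in `InTableClass R` for every `R ≥ 2/0.134`.
[cite: Tao2016AveragedNS, §4 (4.2)–(4.3), §6.1; cell vocabulary (`InTableClass`)] -/
theorem inTableClass_circuitTable {ρ p q g k R : ℝ} (hρ : 0 < ρ) (hρ1 : ρ ≤ 2)
    (hp : 0 < p) (hp1 : p ≤ 1) (hq : 0 < q) (hq1 : q ≤ 1) (hg : 0 < g) (hg1 : g ≤ 1)
    (hk : 0 < k) (hk1 : k ≤ 1) (hRρ : R⁻¹ ≤ ρ / 2) (hRp : R⁻¹ ≤ p / 2) (hRq : R⁻¹ ≤ q / 2)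
    (hRg : R⁻¹ ≤ g / 2) (hRk : R⁻¹ ≤ k / 2) :
    InTableClass R (circuitTable ρ p q g k) :=
  ⟨isSymmetricCoeff_circuitTable ρ p q g k, isCancellingCoeff_circuitTable ρ p q g k,
    isComparableCoeff_circuitTable hρ hρ1 hp hp1 hq hq1 hg hg1 hk hk1 hRρ hRp hRq hRg hRk⟩

end Summit.NavierStokesRegularity.NavierStokesRegularity.Theorems
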